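import Mathlib
import Summits.NavierStokesRegularity.NavierStokesRegularity.Theorems.LerayQuarterDissipationFiniteDissipationLiouvilleLambProductCollar
import HarnessLib

/-!
# Crux `FiniteDissipationLiouville` (stmt-NavierStokesRegularity-22144): THE LOCAL ENSTROPHY-BALANCE
# THRESHOLD — a singular profile must run a pointwise enstrophy-production EXCESS somewhere (Lamb
# form), by a definite factor

Theorems file of route `LerayQuarterDissipation` (lead prover g18; `--supports` the crux; sequel of
`…LambProductThreshold/…LambProductCollar`). Navier–Stokes regularity is NOT proved by anything
here; no summit is.

The global similarity-enstrophy budget of an enveloped KNSS-gauge Type-I field reads `Z' = −2∫e`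
with the LOCAL BALANCE DENSITY `e = ‖curl Ω‖² + ¼‖Ω‖² − ⟪U, Ω × curl Ω⟫` (dissipation density +
scaling density − Lamb-form production density; `…CrossFlowDss`, lead g17). The product row of
`…LambProductThreshold` asks `⟪U, Ω × curl Ω⟫ ≤ ‖Ω‖‖curl Ω‖ (≤ ‖curl Ω‖² + ¼‖Ω‖²)`. The MAXIMAL
hypothesis of this kind is the balance itself:

* **`eq_zero_of_localBalance`** — **every KNSS-gauge Type-I ancient mild field with a Type-I
  envelope whose local balance density is nonnegative EVERYWHERE,
  `⟪U, Ω × curl Ω⟫ ≤ ‖curl Ω‖² + ¼‖Ω‖²` on its Leray orbit — physically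
  `⟪u, ω × curl ω⟫ ≤ ‖curl ω‖² + ‖ω‖²/(4(−t))` at every `t < 0`, `x` — VANISHES IDENTICALLY.**
  The scheme `…EndpointSchemeSlack.eq_zero_of_slack_scheme` applies with the hypothesis AS the
  slack; the rigidity is again by analyticity: in the equality case
  `‖curl Ω‖² + ¼‖Ω‖² = ⟪U, Ω × curl Ω⟫ ≤ ‖U‖(‖curl Ω‖² + ¼‖Ω‖²)`, so the vorticity vanishes wherever
  `‖U‖ < 1`, i.e. outside the envelope's core, hence everywhere. Contains the product threshold one
  (AM–GM `‖Ω‖‖curl Ω‖ ≤ ‖curl Ω‖² + ¼‖Ω‖²`), hence the Λ-directional, cross-flow and time-constant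
  endpoints;
* `localBalance_nsRescale`, `localBalance_sim_of_phys`, `localBalance_closed_of_tendsto` — scale
  invariance, similarity form, KNSS-closedness with moving constants;
* **`exists_localBalance_gap`** — the COLLAR: for every `C` there is `ε = ε(C) > 0` such that even
  `⟪u, ω × curl ω⟫ ≤ (1 + ε)(‖curl ω‖² + ‖ω‖²/(4(−t)))` everywhere forbids an apex singularity on the
  enveloped class (`…LambProductCollar.exists_gap_of_closed`);
* `not_singular_of_localBalance`, **`localBalance_excess_of_singular`** — PORTRAIT: the hypothetical
  singular profile has a space–time point where the Lamb-form enstrophy production exceeds the local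
  dissipation-plus-scaling density by the factor `1 + ε`:
  `(1+ε)(‖curl ω‖² + ‖ω‖²/(4(−t))) < ⟪u, ω × curl ω⟫`.

HONEST FRAMING. This is the sharp form of what the (global, unweighted) similarity-enstrophy method
yields pointwise; it says nothing when the production excess is compensated elsewhere in space, which
is the generic situation; `ε` is ineffective. Necessary conditions on a HYPOTHETICAL object; nothing
is removed from the catalogued DSS wall beyond this sub-class; verdict of the line unchanged
(FRONTIER). Nothing here bears on Navier–Stokes regularity.

References: Koch–Nadirashvili–Seregin–Šverák, Acta Math. 203 (2009) §4; Doering–Gibbon (1995) §1.4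
(Lamb form of the enstrophy production); Lemarié-Rieusset (2016) Thm 9.12 (analyticity).
-/

noncomputable section

set_option linter.dupNamespace false

namespace Summit.NavierStokesRegularity.NavierStokesRegularity.Theorems.FiniteDissipationLiouville.LocalBalance

open MeasureTheory Set Filter Topology Metric InnerProductSpace Function Real
open scoped RealInnerProductSpace ContDiff
open Literature.Analysis Literature.Analysis.FluidPDE
open Summit.NavierStokesRegularity.NavierStokesRegularity.Theorems
open Summit.NavierStokesRegularity.NavierStokesRegularity.Theorems.GaussianGap
open Summit.NavierStokesRegularity.NavierStokesRegularity.Theorems.SimilarityEnstrophy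
open Summit.NavierStokesRegularity.NavierStokesRegularity.Theorems.RecurrentReductionD
open Summit.NavierStokesRegularity.NavierStokesRegularity.Theorems.FiniteDissipationLiouville
open Summit.NavierStokesRegularity.NavierStokesRegularity.Theorems.FiniteDissipationLiouville.CrossFlow
open Summit.NavierStokesRegularity.NavierStokesRegularity.Theorems.FiniteDissipationLiouville.EndpointScheme
open Summit.NavierStokesRegularity.NavierStokesRegularity.Theorems.FiniteDissipationLiouville.LambProduct

variable {C : ℝ} {V : ℝ → EuclideanSpace ℝ (Fin 3) → EuclideanSpace ℝ (Fin 3)}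

/-! ### Pointwise rigidity of the balance -/

section Algebra

/-- **A slow velocity cannot balance**: `θ(‖C‖² + ¼‖Ω‖²) ≤ ⟪U, Ω × C⟫` with `θ‖U‖ < θ`... precisely:
if `‖C‖² + ¼‖Ω‖² ≤ ⟪U, Ω × C⟫` and `‖U‖ < 1` then `Ω = 0`
(`⟪U, Ω × C⟫ ≤ ‖U‖‖Ω‖‖C‖ ≤ ‖U‖(‖C‖² + ¼‖Ω‖²)`). [folklore] -/
theorem eq_zero_of_balance_le_of_norm_lt_one {U Ω C : EuclideanSpace ℝ (Fin 3)}
    (h : ‖C‖ ^ 2 + (1 / 4) * ‖Ω‖ ^ 2 ≤ ⟪U, cross Ω C⟫) (hU : ‖U‖ < 1) : Ω = 0 := by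
  by_contra hne
  have hpos : 0 < ‖Ω‖ := norm_pos_iff.2 hne
  have hle : ⟪U, cross Ω C⟫ ≤ ‖U‖ * (‖Ω‖ * ‖C‖) :=
    (real_inner_le_norm _ _).trans (mul_le_mul_of_nonneg_left (norm_cross_le_norm_mul_norm _ _)
      (norm_nonneg _))
  have hamgm : ‖Ω‖ * ‖C‖ ≤ ‖C‖ ^ 2 + (1 / 4) * ‖Ω‖ ^ 2 := by
    nlinarith [sq_nonneg (‖C‖ - ‖Ω‖ / 2)]
  have hF : 0 < ‖C‖ ^ 2 + (1 / 4) * ‖Ω‖ ^ 2 := by positivity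
  have h1 : ‖U‖ * (‖Ω‖ * ‖C‖) ≤ ‖U‖ * (‖C‖ ^ 2 + (1 / 4) * ‖Ω‖ ^ 2) :=
    mul_le_mul_of_nonneg_left hamgm (norm_nonneg _)
  have : (1 - ‖U‖) * (‖C‖ ^ 2 + (1 / 4) * ‖Ω‖ ^ 2) ≤ 0 := by nlinarith
  have : 0 < (1 - ‖U‖) * (‖C‖ ^ 2 + (1 / 4) * ‖Ω‖ ^ 2) := mul_pos (by linarith) hF
  linarith

/-- The product bound at `θ = 1` implies the local balance (AM–GM). [folklore] -/
theorem localBalance_of_lambProduct {U Ω C : EuclideanSpace ℝ (Fin 3)}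
    (h : ⟪U, cross Ω C⟫ ≤ ‖Ω‖ * ‖C‖) : ⟪U, cross Ω C⟫ ≤ ‖C‖ ^ 2 + (1 / 4) * ‖Ω‖ ^ 2 := by
  nlinarith [sq_nonneg (‖C‖ - ‖Ω‖ / 2)]

end Algebra

/-! ### Scaling bookkeeping -/

section Scaling

/-- **The local balance is scale invariant** (every term carries the factor `c⁶` under `V ↦ V_c`).
[folklore] -/
theorem localBalance_nsRescale {c θ : ℝ} (hc : 0 < c)
    (hP : ∀ t < 0, ∀ x, ⟪V t x, cross (curl (V t) x) (curl (curl (V t)) x)⟫ ≤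
      θ * (‖curl (curl (V t)) x‖ ^ 2 + ‖curl (V t) x‖ ^ 2 / (4 * (-t)))) :
    ∀ t < 0, ∀ x,
      ⟪nsRescale c V t x, cross (curl (nsRescale c V t) x) (curl (curl (nsRescale c V t)) x)⟫ ≤
        θ * (‖curl (curl (nsRescale c V t)) x‖ ^ 2 + ‖curl (nsRescale c V t) x‖ ^ 2 / (4 * (-t))) := by
  intro t ht x
  have hct : c ^ 2 * t < 0 := mul_neg_of_pos_of_neg (by positivity) ht
  have key := hP (c ^ 2 * t) hct (c • x)
  have hcurl : curl (nsRescale c V t) x = (c * c) • curl (V (c ^ 2 * t)) (c • x) := by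
    rw [curl_eq_curlCLM, fderiv_nsRescale, map_smul, ← curl_eq_curlCLM]
  rw [hcurl, curl_curl_nsRescale, nsRescale_apply, cross_smul_left, cross_smul_right,
    real_inner_smul_left, real_inner_smul_right, real_inner_smul_right, norm_smul, norm_smul,
    Real.norm_of_nonneg (by positivity : (0:ℝ) ≤ c * c),
    Real.norm_of_nonneg (by positivity : (0:ℝ) ≤ c * c * c)]
  have ht' : 0 < -t := neg_pos.2 ht
  have h4 : (4 : ℝ) * (-t) ≠ 0 := by positivity
  have h4c : (4 : ℝ) * (-(c ^ 2 * t)) ≠ 0 := by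
    rw [show (4 : ℝ) * (-(c ^ 2 * t)) = c ^ 2 * (4 * (-t)) by ring]; positivity
  have e1 : (c * c * ‖curl (V (c ^ 2 * t)) (c • x)‖) ^ 2 / (4 * (-t)) =
      c ^ 6 * (‖curl (V (c ^ 2 * t)) (c • x)‖ ^ 2 / (4 * (-(c ^ 2 * t)))) := by
    rw [mul_div_assoc', div_eq_div_iff h4 h4c]
    ring
  have e : θ * ((c * c * c * ‖curl (curl (V (c ^ 2 * t))) (c • x)‖) ^ 2 +
      (c * c * ‖curl (V (c ^ 2 * t)) (c • x)‖) ^ 2 / (4 * (-t))) =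
      c ^ 6 * (θ * (‖curl (curl (V (c ^ 2 * t))) (c • x)‖ ^ 2 +
        ‖curl (V (c ^ 2 * t)) (c • x)‖ ^ 2 / (4 * (-(c ^ 2 * t))))) := by
    rw [e1]
    ring
  rw [e]
  have hw : 0 ≤ c ^ 6 := by positivity
  calc c * (c * c * (c * c * c *
        ⟪V (c ^ 2 * t) (c • x), cross (curl (V (c ^ 2 * t)) (c • x)) (curl (curl (V (c ^ 2 * t))) (c • x))⟫))
      = c ^ 6 * ⟪V (c ^ 2 * t) (c • x), cross (curl (V (c ^ 2 * t)) (c • x))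
          (curl (curl (V (c ^ 2 * t))) (c • x))⟫ := by ring
    _ ≤ _ := mul_le_mul_of_nonneg_left key hw

/-- **The local balance in similarity variables**: the physical hypothesis
`⟪V, ω × curl ω⟫ ≤ θ(‖curl ω‖² + ‖ω‖²/(4(−t)))` gives `⟪U, Ω × curl Ω⟫ ≤ θ(‖curl Ω‖² + ¼‖Ω‖²)` on the
Leray orbit (all terms scale by `(−t)³`). [folklore] -/
theorem localBalance_sim_of_phys {θ : ℝ}
    (hP : ∀ t < 0, ∀ x, ⟪V t x, cross (curl (V t) x) (curl (curl (V t)) x)⟫ ≤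
      θ * (‖curl (curl (V t)) x‖ ^ 2 + ‖curl (V t) x‖ ^ 2 / (4 * (-t))))
    (s : ℝ) (y : EuclideanSpace ℝ (Fin 3)) :
    ⟪lerayOrbit V s y, cross (lerayVorticity V s y) (curl (lerayVorticity V s) y)⟫ ≤
      θ * (‖curl (lerayVorticity V s) y‖ ^ 2 + (1 / 4) * ‖lerayVorticity V s y‖ ^ 2) := by
  have hl0 : 0 < Real.exp (-s / 2) := Real.exp_pos _
  have hk0 : 0 < Real.exp (-s) := Real.exp_pos _
  have ht0 : -Real.exp (-s) < 0 := neg_neg_of_pos hk0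
  have hU : lerayOrbit V s y = Real.exp (-s / 2) • V (-Real.exp (-s)) (Real.exp (-s / 2) • y) := by
    rw [lerayOrbit_apply]
  have hΩ : lerayVorticity V s y =
      Real.exp (-s) • curl (V (-Real.exp (-s))) (Real.exp (-s / 2) • y) := by
    rw [lerayVorticity_apply, curl_lerayOrbit]
  have hC := curl_lerayVorticity_apply V s y
  have h := hP _ ht0 (Real.exp (-s / 2) • y)
  rw [neg_neg] at h
  set P : ℝ := ⟪V (-Real.exp (-s)) (Real.exp (-s / 2) • y),
      cross (curl (V (-Real.exp (-s))) (Real.exp (-s / 2) • y))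
        (curl (curl (V (-Real.exp (-s)))) (Real.exp (-s / 2) • y))⟫ with hPdef
  set A : ℝ := ‖curl (V (-Real.exp (-s))) (Real.exp (-s / 2) • y)‖ with hA
  set B : ℝ := ‖curl (curl (V (-Real.exp (-s)))) (Real.exp (-s / 2) • y)‖ with hB
  have hee : Real.exp (-s / 2) * Real.exp (-s / 2) = Real.exp (-s) := by
    rw [← Real.exp_add]; congr 1; ring
  have eL : ⟪lerayOrbit V s y, cross (lerayVorticity V s y) (curl (lerayVorticity V s) y)⟫ =
      Real.exp (-s) ^ 3 * P := by
    rw [hU, hΩ, hC, cross_smul_left, cross_smul_right, real_inner_smul_left, real_inner_smul_right,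
      real_inner_smul_right]
    calc Real.exp (-s / 2) * (Real.exp (-s) * (Real.exp (-s) * Real.exp (-s / 2) * P))
        = (Real.exp (-s / 2) * Real.exp (-s / 2)) * Real.exp (-s) ^ 2 * P := by ring
      _ = Real.exp (-s) ^ 3 * P := by rw [hee]; ring
  have eA : ‖lerayVorticity V s y‖ = Real.exp (-s) * A := by
    rw [hΩ, norm_smul, Real.norm_of_nonneg hk0.le]
  have eB : ‖curl (lerayVorticity V s) y‖ = Real.exp (-s) * Real.exp (-s / 2) * B := by
    rw [hC, norm_smul, Real.norm_of_nonneg (mul_pos hk0 hl0).le]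
  have eR : ‖curl (lerayVorticity V s) y‖ ^ 2 + (1 / 4) * ‖lerayVorticity V s y‖ ^ 2 =
      Real.exp (-s) ^ 3 * (B ^ 2 + A ^ 2 / (4 * Real.exp (-s))) := by
    rw [eA, eB]
    have e3 : Real.exp (-s) ^ 3 * (A ^ 2 / (4 * Real.exp (-s))) = Real.exp (-s) ^ 2 * A ^ 2 / 4 := by
      rw [mul_div_assoc', div_eq_div_iff (by positivity) (by norm_num)]
      ring
    calc (Real.exp (-s) * Real.exp (-s / 2) * B) ^ 2 + 1 / 4 * (Real.exp (-s) * A) ^ 2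
        = Real.exp (-s) ^ 2 * (Real.exp (-s / 2) * Real.exp (-s / 2)) * B ^ 2 +
            Real.exp (-s) ^ 2 * A ^ 2 / 4 := by ring
      _ = Real.exp (-s) ^ 3 * B ^ 2 + Real.exp (-s) ^ 3 * (A ^ 2 / (4 * Real.exp (-s))) := by
          rw [hee, e3]; ring
      _ = Real.exp (-s) ^ 3 * (B ^ 2 + A ^ 2 / (4 * Real.exp (-s))) := by ring
  rw [eL, eR, ← mul_assoc, mul_comm θ, mul_assoc]
  exact mul_le_mul_of_nonneg_left h (by positivity)

end Scaling

/-! ### Closedness under KNSS limits -/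

section Closed

/-- **The local balance is closed under KNSS limits with moving constants `θ_j → θ`.**
[cite: KochNadirashviliSereginSverak2009, Prop. 4.1 (arXiv:0709.3599 p. 8)] -/
theorem localBalance_closed_of_tendsto {v : ℕ → ℝ → EuclideanSpace ℝ (Fin 3) → EuclideanSpace ℝ (Fin 3)}
    {W : ℝ → EuclideanSpace ℝ (Fin 3) → EuclideanSpace ℝ (Fin 3)}
    (hv : ∀ j, IsTypeIAncientMild C (v j)) (hW : IsTypeIAncientMild C W)
    (hunif : ∀ n : ℕ, TendstoUniformlyOn (fun j z => v j z.1 z.2) (fun z => W z.1 z.2) atTop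
      (Icc (-((n : ℝ) + 2)) (-(1 / ((n : ℝ) + 2))) ×ˢ
        closedBall (0 : EuclideanSpace ℝ (Fin 3)) ((n : ℝ) + 2)))
    (hpt : ∀ t < 0, ∀ x, Tendsto (fun j => v j t x) atTop (𝓝 (W t x)))
    (hgr : ∀ t < 0, ∀ x, Tendsto (fun j => fderiv ℝ (v j t) x) atTop (𝓝 (fderiv ℝ (W t) x)))
    {θ : ℕ → ℝ} {θinf : ℝ} (hθ : Tendsto θ atTop (𝓝 θinf))
    (hP : ∀ j, ∀ t < 0, ∀ x, ⟪v j t x, cross (curl (v j t) x) (curl (curl (v j t)) x)⟫ ≤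
        θ j * (‖curl (curl (v j t)) x‖ ^ 2 + ‖curl (v j t) x‖ ^ 2 / (4 * (-t)))) :
    ∀ t < 0, ∀ x, ⟪W t x, cross (curl (W t) x) (curl (curl (W t)) x)⟫ ≤
      θinf * (‖curl (curl (W t)) x‖ ^ 2 + ‖curl (W t) x‖ ^ 2 / (4 * (-t))) := by
  intro t ht x
  obtain ⟨a, ha⟩ : ∃ a : ℕ → EuclideanSpace ℝ (Fin 3), ∀ j, a j = v j t x := ⟨_, fun j => rfl⟩
  obtain ⟨b, hb⟩ : ∃ b : ℕ → EuclideanSpace ℝ (Fin 3), ∀ j, b j = curl (v j t) x := ⟨_, fun j => rfl⟩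
  obtain ⟨d, hd⟩ : ∃ d : ℕ → EuclideanSpace ℝ (Fin 3), ∀ j, d j = curl (curl (v j t)) x :=
    ⟨_, fun j => rfl⟩
  have hta : Tendsto a atTop (𝓝 (W t x)) := (hpt t ht x).congr fun j => (ha j).symm
  have htb : Tendsto b atTop (𝓝 (curl (W t) x)) :=
    (tendsto_curl_of_fderiv (hgr t ht x)).congr fun j => (hb j).symm
  have htd : Tendsto d atTop (𝓝 (curl (curl (W t)) x)) :=
    (tendsto_curl_curl_of_unif hv hW hunif ht x).congr fun j => (hd j).symm
  have hcr : Tendsto (fun j => cross (b j) (d j)) atTop (𝓝 (cross (curl (W t) x) (curl (curl (W t)) x))) := by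
    have h := ((crossCLM.continuous₂).tendsto (curl (W t) x, curl (curl (W t)) x)).comp
      (htb.prodMk_nhds htd)
    refine h.congr fun j => ?_
    simp [Function.comp, crossCLM_apply]
  have hL : Tendsto (fun j => ⟪a j, cross (b j) (d j)⟫) atTop
      (𝓝 ⟪W t x, cross (curl (W t) x) (curl (curl (W t)) x)⟫) := hta.inner hcr
  have hR : Tendsto (fun j => θ j * (‖d j‖ ^ 2 + ‖b j‖ ^ 2 / (4 * (-t)))) atTop
      (𝓝 (θinf * (‖curl (curl (W t)) x‖ ^ 2 + ‖curl (W t) x‖ ^ 2 / (4 * (-t))))) :=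
    hθ.mul ((htd.norm.pow 2).add ((htb.norm.pow 2).div_const _))
  exact le_of_tendsto_of_tendsto' hL hR fun j => by rw [ha, hb, hd]; exact hP j t ht x

end Closed

/-! ### The threshold and its collar -/

section Threshold

/-- **THE LOCAL ENSTROPHY-BALANCE THRESHOLD (law-free).** A KNSS-gauge Type-I ancient mild field `V`
(`IsTypeIAncientMild C V`) with a Type-I envelope `HasTypeIDecay C V` whose Lamb-form enstrophy
production never exceeds the local dissipation-plus-scaling density,
`⟪V(t,x), ω × curl ω⟫ ≤ ‖curl ω‖² + ‖ω‖²/(4(−t))` at every `t < 0`, `x` (`ω = curl V(t)`), vanishes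
identically on `t < 0`. (The hypothesis IS the pointwise nonnegativity of the slack of the global
similarity-enstrophy budget; equality case + envelope + analyticity.) [folklore energy method + KNSS compactness] -/
theorem eq_zero_of_localBalance (hV : IsTypeIAncientMild C V) (hdec : HasTypeIDecay C V)
    (hP : ∀ t < 0, ∀ x, ⟪V t x, cross (curl (V t) x) (curl (curl (V t)) x)⟫ ≤
      ‖curl (curl (V t)) x‖ ^ 2 + ‖curl (V t) x‖ ^ 2 / (4 * (-t))) :
    ∀ t < 0, ∀ x, V t x = 0 := by
  have hP1 : ∀ t < 0, ∀ x, ⟪V t x, cross (curl (V t) x) (curl (curl (V t)) x)⟫ ≤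
      1 * (‖curl (curl (V t)) x‖ ^ 2 + ‖curl (V t) x‖ ^ 2 / (4 * (-t))) := fun t ht x => by
    rw [one_mul]; exact hP t ht x
  refine eq_zero_of_slack_scheme (C := C)
    (P := fun F => ∀ t < 0, ∀ x, ⟪F t x, cross (curl (F t) x) (curl (curl (F t)) x)⟫ ≤
      1 * (‖curl (curl (F t)) x‖ ^ 2 + ‖curl (F t) x‖ ^ 2 / (4 * (-t))))
    (fun F c hc hF => localBalance_nsRescale hc hF)
    (fun u W hu _ hPu hW hunif hpt hgr => localBalance_closed_of_tendsto hu hW hunif hpt hgr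
      (θ := fun _ => 1) tendsto_const_nhds hPu)
    (fun F hF _ hPF s y => ?_) (fun F hF hdF hPF s hσ => ?_) hV hdec hP1
  · have h := localBalance_sim_of_phys hPF s y
    rw [one_mul] at h
    linarith
  · refine lerayVorticity_eq_zero_of_eqOn_far hF s (R := max C 0) fun y hy => ?_
    have h := localBalance_sim_of_phys hPF s y
    rw [one_mul] at h
    have heq : ‖curl (lerayVorticity F s) y‖ ^ 2 + (1 / 4) * ‖lerayVorticity F s y‖ ^ 2 ≤
        ⟪lerayOrbit F s y, cross (lerayVorticity F s y) (curl (lerayVorticity F s) y)⟫ := by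
      linarith [hσ y]
    refine eq_zero_of_balance_le_of_norm_lt_one heq ?_
    have hUle := hdF.norm_lerayOrbit_le s y
    have hden : 0 < ‖y‖ + 1 := by positivity
    have hA : C < ‖y‖ + 1 := by linarith [le_max_left C 0, le_max_right C 0]
    exact hUle.trans_lt ((div_lt_one hden).2 hA)

/-- **Regularity form.** [folklore] -/
theorem not_singular_of_localBalance (hV : IsTypeIAncientMild C V) (hdec : HasTypeIDecay C V)
    (hP : ∀ t < 0, ∀ x, ⟪V t x, cross (curl (V t) x) (curl (curl (V t)) x)⟫ ≤
      ‖curl (curl (V t)) x‖ ^ 2 + ‖curl (V t) x‖ ^ 2 / (4 * (-t))) :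
    ¬ (∀ r > 0, ∀ M : ℝ, ∃ t ∈ Set.Ioo (-(r ^ 2)) (0 : ℝ),
        ∃ x ∈ Metric.ball (0 : EuclideanSpace ℝ (Fin 3)) r, M < ‖V t x‖) := by
  intro hsing
  obtain ⟨t, ht, x, -, hM⟩ := hsing 1 one_pos 0
  rw [eq_zero_of_localBalance hV hdec hP t ht.2 x, norm_zero] at hM
  exact lt_irrefl _ hM

/-- The product threshold one re-derived from the local balance (AM–GM); an `example`, the
declaration of record being `…LambProduct.eq_zero_of_lambProduct_le_one`. [folklore] -/
example (hV : IsTypeIAncientMild C V) (hdec : HasTypeIDecay C V)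
    (hP : ∀ t < 0, ∀ x, Real.sqrt (-t) * ⟪V t x, cross (curl (V t) x) (curl (curl (V t)) x)⟫ ≤
      ‖curl (V t) x‖ * ‖curl (curl (V t)) x‖) :
    ∀ t < 0, ∀ x, V t x = 0 := by
  refine eq_zero_of_localBalance hV hdec fun t ht x => ?_
  have ht' : 0 < -t := neg_pos.2 ht
  set r : ℝ := Real.sqrt (-t) with hr
  have hs : 0 < r := Real.sqrt_pos.2 ht'
  have hss : r * r = -t := Real.mul_self_sqrt ht'.le
  set a : ℝ := ‖curl (V t) x‖
  set b : ℝ := ‖curl (curl (V t)) x‖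
  set p : ℝ := ⟪V t x, cross (curl (V t) x) (curl (curl (V t)) x)⟫
  have h1 : r * p ≤ a * b := hP t ht x
  -- `ab ≤ r b² + a²/(4r)`, i.e. `4rab ≤ 4r²b² + a²`
  have h2 : a * b ≤ r * (b ^ 2 + a ^ 2 / (4 * (-t))) := by
    rw [← hss]
    have e : r * (b ^ 2 + a ^ 2 / (4 * (r * r))) = (4 * r ^ 2 * b ^ 2 + a ^ 2) / (4 * r) := by
      rw [eq_div_iff (by positivity)]
      field_simp
    rw [e, le_div_iff₀ (by positivity)]
    nlinarith [sq_nonneg (2 * r * b - a)]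
  exact le_of_mul_le_mul_left (h1.trans h2) hs

/-- **THE COLLAR OF THE LOCAL BALANCE.** For every `C` there is `ε = ε(C) > 0` such that no KNSS-gauge
Type-I field with `IsTypeIAncientMild C V`, `HasTypeIDecay C V` and
`⟪V, ω × curl ω⟫ ≤ (1 + ε)(‖curl ω‖² + ‖ω‖²/(4(−t)))` everywhere is singular at the apex.
[cite: KochNadirashviliSereginSverak2009, §4 (arXiv:0709.3599 p. 8)] -/
theorem exists_localBalance_gap (C : ℝ) : ∃ ε : ℝ, 0 < ε ∧
    ∀ V : ℝ → EuclideanSpace ℝ (Fin 3) → EuclideanSpace ℝ (Fin 3), IsTypeIAncientMild C V →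
      HasTypeIDecay C V →
      (∀ t < 0, ∀ x, ⟪V t x, cross (curl (V t) x) (curl (curl (V t)) x)⟫ ≤
        (1 + ε) * (‖curl (curl (V t)) x‖ ^ 2 + ‖curl (V t) x‖ ^ 2 / (4 * (-t)))) →
      ¬ (∀ r > 0, ∀ M : ℝ, ∃ t ∈ Ioo (-(r ^ 2)) (0 : ℝ),
        ∃ x ∈ ball (0 : EuclideanSpace ℝ (Fin 3)) r, M < ‖V t x‖) := by
  refine exists_gap_of_closed (C := C) (θ₀ := 1)
    (P := fun θ F => ∀ t < 0, ∀ x, ⟪F t x, cross (curl (F t) x) (curl (curl (F t)) x)⟫ ≤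
      θ * (‖curl (curl (F t)) x‖ ^ 2 + ‖curl (F t) x‖ ^ 2 / (4 * (-t))))
    (fun u W θ θinf hu hPu hθ hW hunif hpt hgr =>
      localBalance_closed_of_tendsto hu hW hunif hpt hgr hθ hPu)
    (fun V hV hdec hP => not_singular_of_localBalance hV hdec fun t ht x => ?_)
  have := hP t ht x
  rwa [one_mul] at this

/-- **PORTRAIT: a definite local production excess somewhere.** For every `A` there is
`ε = ε(A) > 0` such that every KNSS-gauge Type-I field with `IsTypeIAncientMild C V`, `C ≤ A`, a
Type-I envelope `HasTypeIDecay A V`, SINGULAR at the apex, has a point `(t,x)`, `t < 0`, with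
`(1 + ε)(‖curl ω‖² + ‖ω‖²/(4(−t))) < ⟪V(t,x), ω × curl ω⟫` — the Lamb-form enstrophy production
exceeds the local dissipation-plus-scaling density by a definite factor.
[folklore energy method + KNSS compactness] -/
theorem localBalance_excess_of_singular (A : ℝ) : ∃ ε : ℝ, 0 < ε ∧
    ∀ (C : ℝ) (V : ℝ → EuclideanSpace ℝ (Fin 3) → EuclideanSpace ℝ (Fin 3)),
      IsTypeIAncientMild C V → C ≤ A → HasTypeIDecay A V →
      (∀ r > 0, ∀ M : ℝ, ∃ t ∈ Ioo (-(r ^ 2)) (0 : ℝ),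
        ∃ x ∈ ball (0 : EuclideanSpace ℝ (Fin 3)) r, M < ‖V t x‖) →
      ∃ t : ℝ, t < 0 ∧ ∃ x : EuclideanSpace ℝ (Fin 3),
        (1 + ε) * (‖curl (curl (V t)) x‖ ^ 2 + ‖curl (V t) x‖ ^ 2 / (4 * (-t))) <
          ⟪V t x, cross (curl (V t) x) (curl (curl (V t)) x)⟫ := by
  obtain ⟨ε, hε, h⟩ := exists_localBalance_gap A
  refine ⟨ε, hε, fun C V hV hCA hdec hsing => ?_⟩
  by_contra hc
  push Not at hc
  exact h V (isTypeIAncientMild_of_le hV hCA) hdec hc hsing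

end Threshold

end Summit.NavierStokesRegularity.NavierStokesRegularity.Theorems.FiniteDissipationLiouville.LocalBalance

end
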